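import Summits.Ventures.HodgeRepro2.T5FinitePlaceSplitClassification
import Summits.Ventures.HodgeRepro2.T5SplitUnitaryGroupEquiv
import Summits.Ventures.HodgeRepro2.T5FinitePlaceTensorClassification
import Summits.Ventures.HodgeRepro2.T5FinitePlaceTensorEquiv

/-!
# The record's `U(V)(F⁺_v)` at a split place is `GL_n(F⁺_v)` (cell pub-hodge-repro2, seat p3)

Tier-5 N3 support and route/T4-B1-p3.md's sentence «`U(V_v) ≅ GL₃(F⁺_v)` at a place `v` split in `E`», on the
route's own objects. The record's local algebra at a finite place `v` of `K⁺` is `K⁺_v ⊗_{K⁺} K` with the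
conjugation `1 ⊗ c` (file 134's `tensorStarRing`); at a SPLIT place (`w ≠ w'` above `v`, `c • w = w'`, `θ` a
`v`-adic square) file 134's `splitEquiv : K⁺_v ⊗ K ≃+* K_w × K_w` carries `1 ⊗ c` to the swap. For a hermitian
Gram matrix `H` over `K` (Mathlib's CM star) this file proves:
* `unitaryMapEquiv e he J : U(J) ≃* U(J.map e)` — the isometry group transported along ANY star-compatible ring
  isomorphism `e` (generic; `mem_formUnitaryGroup_map_iff`);
* `map_complexConj_eq_transpose` — a hermitian `H` over `K` has `H.map c = Hᵀ`;
* `tensorGram_map_splitEquiv` — the Gram matrix `1 ⊗ H` over `K⁺_v ⊗ K` reads, through `splitEquiv`, as the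
  pair `(H_w, H_wᵀ) = hermitianPair H_w` with `H_w := H.map (K → K_w)`;
* **`recordSplitEquiv : U(1 ⊗ H) ≃* GL_n(K_w)`** — the record's local unitary group at a split place IS a general
  linear group (files 144 / 224 through `splitEquiv`), and **`recordSplitEquiv' : U(1 ⊗ H) ≃* GL_n(K⁺_v)`**
  through `K⁺_v ≃+* K_w` (file 127's `completionEquivOfIsSquare`, the bijective `completionMap` at a split place).
What is NOT here: the integral points (`K_v`) on the tensor side — file 224's `splitHyperspecial` lives on
`K_w × K_w`, where the record's «`K_v ↦ GL_n(𝒪_v)`» is `splitUnitaryEquiv_mem_range_iff`.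

Mathlib + this seat's files 122 / 127 / 131 / 134 / 144 / 224 and their imports; no display; no device.
§8(d): uses an L-value-free non-vanishing device: NO.
-/

namespace Summit.Ventures.HodgeRepro2.T5SplitPlaceUnitaryGroup

open Matrix NumberField NumberField.IsCMField IsDedekindDomain IsDedekindDomain.HeightOneSpectrum
open scoped TensorProduct Pointwise
open Summit.Ventures.HodgeRepro2.T5SplitHermitianClass Summit.Ventures.HodgeRepro2.T5SplitUnitaryGroup
  Summit.Ventures.HodgeRepro2.T5UnitaryGroupForm Summit.Ventures.HodgeRepro2.T5SplitUnitaryGroupEquiv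
  Summit.Ventures.HodgeRepro2.T5FinitePlaceSplitClassification Summit.Ventures.HodgeRepro2.T5FinitePlaceSplitProduct
  Summit.Ventures.HodgeRepro2.T5FinitePlaceGaloisTransport Summit.Ventures.HodgeRepro2.T5FinitePlaceLiesOver
  Summit.Ventures.HodgeRepro2.T5FinitePlaceSplitConj

/-! ## Transport of the isometry group along a star-compatible ring isomorphism -/

section Transport

variable {E E' : Type*} [CommRing E] [CommRing E'] [StarRing E] [StarRing E']
  {ι : Type*} [Fintype ι] [DecidableEq ι]
variable (e : E ≃+* E') (he : ∀ x : E, e (star x) = star (e x))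

omit [StarRing E] [StarRing E'] in
/-- The matrix of `GL.map e g` is `(g : Matrix).map e`. -/
theorem coe_map_equiv (g : GL ι E) :
    ((Matrix.GeneralLinearGroup.map (e : E →+* E') g : GL ι E') : Matrix ι ι E') =
      (g : Matrix ι ι E).map e := rfl

include he in
/-- `g` is an isometry of `J` iff `GL.map e g` is an isometry of `J.map e`. -/
theorem mem_formUnitaryGroup_map_iff (J : Matrix ι ι E) (g : GL ι E) :
    Matrix.GeneralLinearGroup.map (e : E →+* E') g ∈ formUnitaryGroup (J.map e) ↔
      g ∈ formUnitaryGroup J := by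
  rw [mem_formUnitaryGroup_iff, mem_formUnitaryGroup_iff, coe_map_equiv,
    ← Matrix.conjTranspose_map (e : E → E') he, ← Matrix.map_mul, ← Matrix.map_mul]
  exact (Matrix.map_injective e.injective).eq_iff

include he in
/-- `e.symm` is star-compatible too. -/
theorem symm_star (x : E') : e.symm (star x) = star (e.symm x) := by
  apply e.injective
  rw [e.apply_symm_apply, he, e.apply_symm_apply]

/-- **The isometry group transported along a star-compatible ring isomorphism**: `U(J) ≃* U(J.map e)`. -/
noncomputable def unitaryMapEquiv (J : Matrix ι ι E) :
    ↥(formUnitaryGroup J) ≃* ↥(formUnitaryGroup (J.map e)) where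
  toFun g := ⟨Matrix.GeneralLinearGroup.map (e : E →+* E') g.1, (mem_formUnitaryGroup_map_iff e he J g.1).mpr g.2⟩
  invFun g := ⟨Matrix.GeneralLinearGroup.map (e.symm : E' →+* E) g.1, by
    have h := (mem_formUnitaryGroup_map_iff e.symm (symm_star e he) (J.map e) g.1).mpr g.2
    have h2 : (J.map e).map e.symm = J := T5FinitePlaceTensorClassification.map_map_symm_ringEquiv e J
    rwa [h2] at h⟩
  left_inv g := by
    apply Subtype.ext
    apply Units.ext
    exact T5FinitePlaceTensorClassification.map_map_symm_ringEquiv e _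
  right_inv g := by
    apply Subtype.ext
    apply Units.ext
    change ((g.1 : Matrix ι ι E').map e.symm).map e = (g.1 : Matrix ι ι E')
    rw [Matrix.map_map]
    exact Matrix.ext fun i j => e.apply_symm_apply _
  map_mul' g g' := Subtype.ext (map_mul (Matrix.GeneralLinearGroup.map (e : E →+* E')) g.1 g'.1)

/-- `unitaryMapEquiv` is `GL.map e` on the underlying matrices. -/
theorem coe_unitaryMapEquiv (J : Matrix ι ι E) (g : ↥(formUnitaryGroup J)) :
    (((unitaryMapEquiv e he J g).1 : GL ι E') : Matrix ι ι E') = (g.1 : Matrix ι ι E).map e := rfl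

end Transport

/-! ## The record's Gram matrix at a split place -/

section Record

variable (K : Type*) [Field K] [NumberField K] [IsCMField K]
variable (v : HeightOneSpectrum (𝓞 (maximalRealSubfield K))) (w w' : HeightOneSpectrum (𝓞 K))
  [w.asIdeal.LiesOver v.asIdeal] [w'.asIdeal.LiesOver v.asIdeal]
  (hw : complexConj K • w.asIdeal = w'.asIdeal)
variable {θ : maximalRealSubfield K} {y : K}
  (hθ : algebraMap (maximalRealSubfield K) K θ = y ^ 2) (hy : complexConj K y ≠ y)
  (hne : w ≠ w')
  (hsq : IsSquare (algebraMap (maximalRealSubfield K) (v.adicCompletion (maximalRealSubfield K)) θ))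
variable {n : Type*} [Fintype n] [DecidableEq n]

/-- The Gram matrix `H` over `K` read in the local algebra `K⁺_v ⊗ K`: `1 ⊗ H`. -/
noncomputable def tensorGram (H : Matrix n n K) :
    Matrix n n ((v.adicCompletion (maximalRealSubfield K)) ⊗[maximalRealSubfield K] K) :=
  H.map fun x => (1 : v.adicCompletion (maximalRealSubfield K)) ⊗ₜ x

omit [IsCMField K] [Fintype n] [DecidableEq n] in
/-- `tensorGram H i j = 1 ⊗ H i j`. -/
theorem tensorGram_apply (H : Matrix n n K) (i j : n) :
    tensorGram K v H i j = (1 : v.adicCompletion (maximalRealSubfield K)) ⊗ₜ H i j := rfl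

omit [Fintype n] [DecidableEq n] in
/-- A hermitian matrix over the CM field `K` (Mathlib's star `= complexConj K`) has `H.map c = Hᵀ`. -/
theorem map_complexConj_eq_transpose {H : Matrix n n K} (hH : H.IsHermitian) :
    H.map (complexConj K) = Hᵀ := by
  ext j i
  exact hH.apply i j

/-- The transport `K_{w'} → K_w` by the conjugation, on the image of `K`: `x ↦ c x`. -/
theorem transport_algebraMap (x : K) :
    transport w' w (complexConj K) (complexConj_smul_eq K w w' hw) (algebraMap K (w'.adicCompletion K) x) =
      algebraMap K (w.adicCompletion K) (complexConj K x) :=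
  transport_coe w' w (complexConj K) (complexConj_smul_eq K w w' hw) x

omit [Fintype n] [DecidableEq n] in
include hw in
/-- **The Gram matrix `1 ⊗ H` reads, through `splitEquiv`, as the pair `(H_w, H_wᵀ)`**, `H_w := H.map (K → K_w)`,
for `H` hermitian over `K`. -/
theorem tensorGram_map_splitEquiv {H : Matrix n n K} (hH : H.IsHermitian) :
    (tensorGram K v H).map (splitEquiv K v w w' hw hθ hy hne hsq) =
      hermitianPair (H.map (algebraMap K (w.adicCompletion K))) := by
  refine Matrix.ext fun i j => ?_
  rw [Matrix.map_apply, tensorGram_apply, splitEquiv_apply, prodLift_one_tmul, transport_algebraMap K w w' hw,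
    hermitianPair, pairMatrix, Matrix.of_apply, Matrix.transpose_apply, Matrix.map_apply, Matrix.map_apply,
    show complexConj K (H i j) = H j i from hH.apply j i]

omit [IsCMField K] in
/-- `H_w` is invertible when `H` is. -/
theorem isUnit_det_map_adicCompletion {H : Matrix n n K} (hdet : IsUnit H.det) :
    IsUnit (H.map (algebraMap K (w.adicCompletion K))).det :=
  isUnit_det_map (algebraMap K (w.adicCompletion K)) H hdet

include hw in
/-- **THE RECORD'S `U(V)(F⁺_v)` AT A SPLIT PLACE IS `GL_n(K_w)`**: the isometry group of `1 ⊗ H` over the local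
algebra `K⁺_v ⊗ K` with the conjugation `1 ⊗ c` is isomorphic to `GL_n(K_w)` — `splitEquiv` carries it onto the
isometry group of `(H_w, H_wᵀ)` over `(K_w × K_w, swap)` (`unitaryMapEquiv`), which is `GL_n(K_w)` by the
first projection (file 224's `splitUnitaryEquiv`). -/
noncomputable def recordSplitEquiv {H : Matrix n n K} (hH : H.IsHermitian) (hdet : IsUnit H.det) :
    (letI := tensorStarRing K v; ↥(formUnitaryGroup (tensorGram K v H))) ≃* GL n (w.adicCompletion K) := by
  letI := tensorStarRing K v
  letI := swapStarRing (w.adicCompletion K)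
  exact (unitaryMapEquiv (splitEquiv K v w w' hw hθ hy hne hsq) (splitEquiv_star K v w w' hw hθ hy hne hsq)
      (tensorGram K v H)).trans
    ((MulEquiv.subgroupCongr (congrArg formUnitaryGroup (tensorGram_map_splitEquiv K v w w' hw hθ hy hne hsq hH))).trans
      (splitUnitaryEquiv _ (isUnit_det_map_adicCompletion K w hdet)))

/-- `recordSplitEquiv` on the underlying matrices: the first component of `splitEquiv` applied entrywise. -/
theorem coe_recordSplitEquiv {H : Matrix n n K} (hH : H.IsHermitian) (hdet : IsUnit H.det)
    (g : (letI := tensorStarRing K v; ↥(formUnitaryGroup (tensorGram K v H)))) :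
    ((recordSplitEquiv K v w w' hw hθ hy hne hsq hH hdet g : GL n (w.adicCompletion K)) :
        Matrix n n (w.adicCompletion K)) =
      ((g.1 : Matrix n n ((v.adicCompletion (maximalRealSubfield K)) ⊗[maximalRealSubfield K] K)).map
        (splitEquiv K v w w' hw hθ hy hne hsq)).map Prod.fst := rfl

include hw in
/-- **`U(V)(F⁺_v) ≅ GL_n(F⁺_v)` AT A SPLIT PLACE** — route/T4-B1-p3.md's sentence on the route's own objects:
`recordSplitEquiv` followed by `GL_n(K_w) ≅ GL_n(K⁺_v)` along file 127's `completionEquivOfIsSquare` (with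
`K = K⁺ + K⁺ y`, file 122's `span_pair_eq_top`). -/
noncomputable def recordSplitEquiv' {H : Matrix n n K} (hH : H.IsHermitian) (hdet : IsUnit H.det) :
    (letI := tensorStarRing K v; ↥(formUnitaryGroup (tensorGram K v H))) ≃*
      GL n (v.adicCompletion (maximalRealSubfield K)) :=
  (recordSplitEquiv K v w w' hw hθ hy hne hsq hH hdet).trans
    (Units.mapEquiv (RingEquiv.mapMatrix (T5FinitePlaceTensorEquiv.completionEquivOfIsSquare v w hθ.symm
      (T5FinitePlaceCM.span_pair_eq_top K hy) hsq).symm).toMulEquiv)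

end Record

end Summit.Ventures.HodgeRepro2.T5SplitPlaceUnitaryGroup
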